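import Summits.PneNP.PneNP.Theses.NtimeComplementLadder
import Literature.Computability.Complexity.PaulPippengerSzemerediTrotter1983Proofs
import Literature.Computability.Complexity.DTIMESubsetNTIMELinear

/-!
# Line `detspeedup` (door D) for crux `ConlinNotInNlin` (`stmt-PneNP-18521`)

Strategist alternative to the registered birth line (door W).  Door W's hardest stub is an OPEN
*nondeterministic* speed-up `NTIME g ⊆ sigmaLin j` (open since 1983; `j ≥ 2` forced by
`Negative.stub_speedup_false_at_level_le_one`).  This line swaps it for the PRINTED *deterministic*
speed-up of Paul–Pippenger–Szemerédi–Trotter 1983 (`DTIME(n log* n) ⊆ Σ₄TIME(n)`, exactly the hypothesis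
`hspeed` of the tree's `PaulEtAl1983_NTIME_not_subset_DTIME_of_speedup_logStar`) and moves the open content to a
*different* lower bound: `DTIME(n·log* n) ⊄ NTIME(n)` — the `t = n log* n` instance of the open question
"is DTIME(t) ⊆ NTIME(n) for some superlinear t?" (Salamon–Wehar 2022, arXiv:2111.02138, §1/§6).

Seam (kernel-checked below, `ConlinNotInNlin_of`): if `coNTIME(n) ⊆ NTIME(n)` then, with linear-witness
absorption, every level `sigmaLin k` collapses into `NTIME(n)` (induction on `k`:
`sigmaLin (k+1) = ∃ˡⁱⁿ· co (sigmaLin k) ⊆ ∃ˡⁱⁿ· coNTIME(n) ⊆ ∃ˡⁱⁿ· NTIME(n) ⊆ NTIME(n)`), hence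
`DTIME(n log* n) ⊆ sigmaLin 4 ⊆ NTIME(n)`, contradicting the lower-bound stub.
-/

set_option linter.dupNamespace false

namespace Summit.PneNP.PneNP.Cruxes.ConlinNotInNlin.DetSpeedup

open Filter Asymptotics Literature.Computability.Complexity

/-- **stub_absorb** [M, provable; shared verbatim with the birth line]: a linearly bounded existential
witness in front of an `NTIME(n)` verifier is absorbed into the nondeterminism (guess the witness on a
spare stack, then run the verifier on `boolPair w x`, `|w| ≤ c|x|+c`). [BDG I, Thm 8.3 at linear time] -/
theorem stub_absorb : linExists (NTIME (fun n : ℕ => n)) ⊆ NTIME (fun n : ℕ => n) := by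
  sorry

/-- **stub_ppstSpeedup** [XL, printed theorem]: the Paul–Pippenger–Szemerédi–Trotter speed-up of
deterministic linear(ish) time by four alternations, `DTIME(n·log* n) ⊆ Σ₄TIME(n)`
[PPST 1983 (FOCS), Thm 3 / JACM-version Thm 4.1; = hypothesis `hspeed` of
`PaulEtAl1983_NTIME_not_subset_DTIME_of_speedup_logStar`].  Deterministic: NOT an instance of the refuted
`j ≤ 1` slice of door W (`Negative.stub_speedup_false_at_level_le_one` concerns `NTIME g`). -/
theorem stub_ppstSpeedup :
    DTIME (fun n => n * (logStar n + 1)) ⊆ sigmaLin 4 := by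
  sorry

/-- **stub_dlevelNotInNlin** [open; the line's bet]: a little more deterministic time is not captured by
nondeterministic linear time, `DTIME(n·log* n) ⊄ NTIME(n)`.  Strictly weaker than `DTIME(n log n) ⊄ NTIME(n)`,
whose negation gives `SAT ∈ NTIME(n)∩…` consequences (Salamon–Wehar 2022, Cor. 16); no diagonal proof is
known (a nondeterministic machine cannot be forward-simulated deterministically), so the intended attack is
structural: under `DTIME(n log* n) ⊆ NTIME(n)` iterate padding + PPST to collapse `DTIME(n (log* n)^k)` into
`NTIME(n)` for all `k` and reach a class with a known NLIN lower bound. -/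
theorem stub_dlevelNotInNlin :
    ¬ (DTIME (fun n => n * (logStar n + 1)) ⊆ NTIME (fun n : ℕ => n)) := by
  sorry

/-- Seam lemma (proved): under `coNTIME(n) ⊆ NTIME(n)` and absorption, the whole linear-time hierarchy
sits inside `NTIME(n)`. -/
theorem sigmaLin_subset_NTIME_id_of_coNTIME_subset
    (habs : linExists (NTIME (fun n : ℕ => n)) ⊆ NTIME (fun n : ℕ => n))
    (hco : coNTIME (fun n : ℕ => n) ⊆ NTIME (fun n : ℕ => n)) :
    ∀ k, sigmaLin k ⊆ NTIME (fun n : ℕ => n)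
  | 0 => by rw [sigmaLin_zero]; exact DTIME_id_subset_NTIME_id
  | k + 1 => by
    rw [sigmaLin_succ, piLin]
    have ih := sigmaLin_subset_NTIME_id_of_coNTIME_subset habs hco k
    have hco' : co (NTIME (fun n : ℕ => n)) ⊆ NTIME (fun n : ℕ => n) := hco
    exact (linExists_mono ((co_mono ih).trans hco')).trans habs

/-- **Composition (kernel-checked, sorry-free).** The three stubs give the crux BY NAME. -/
theorem ConlinNotInNlin_of :
    (linExists (NTIME (fun n : ℕ => n)) ⊆ NTIME (fun n : ℕ => n)) →
    (DTIME (fun n => n * (logStar n + 1)) ⊆ sigmaLin 4) →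
    (¬ (DTIME (fun n => n * (logStar n + 1)) ⊆ NTIME (fun n : ℕ => n))) →
    Summit.PneNP.PneNP.Theses.NtimeComplementLadder.ConlinNotInNlin := by
  intro habs hspeed hnot hco
  exact hnot (hspeed.trans (sigmaLin_subset_NTIME_id_of_coNTIME_subset habs hco 4))

/-- The line instantiated with its own stubs. -/
theorem ConlinNotInNlin_via_detspeedup :
    Summit.PneNP.PneNP.Theses.NtimeComplementLadder.ConlinNotInNlin :=
  ConlinNotInNlin_of stub_absorb stub_ppstSpeedup stub_dlevelNotInNlin

end Summit.PneNP.PneNP.Cruxes.ConlinNotInNlin.DetSpeedup
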